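import Summits.QuantumFields.BalabanUV.Beta.EriceFlowEnclosureB12AsPrintedHistoryContagionShiftFlowZeroSemigroup

/-!
# Beta / EriceFlowEnclosureB12AsPrintedHistoryContagionShiftFlowZeroSemigroupBackward — ASYMPTOTIC FREEDOM IS CONTAGIOUS, part 54: NEGATIVE TIMES OF THE CONTINUOUS
# RENORMALIZATION GROUP — THE INFRARED CONTINUATION, THE EXPLICIT INVERSE RENORMALIZATION STEP, THE EDGE OF THE SMALL BOX.  Part 46's semigroup
# `φ_s g = Λ⁻¹(Λ g + sβ₀)` (s ≥ 0) runs every coupling of the small box ]0, e′] INTO THE ULTRAVIOLET.  The same expression makes sense for EVERY REAL TIME s with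
# `Λ g + sβ₀ ≥ Λ e′` (§84, ABSTRACT: Λ strictly antitone on ]0, e′] onto `[Λ e′, ∞[`): the maps form a LOCAL ONE-PARAMETER GROUP — `φ_{s+s′} = φ_s ∘ φ_{s′}` wherever
# defined (`rg_add_of_le`), `φ_{−s} ∘ φ_s = id` (`rg_neg_rg`, `rg_rg_neg`) —, every coupling g of the small box is **`g = φ_{T(g)}(e′)`, `T(g) = (Λ g − Λ e′)∕β₀`**
# (`rg_time_eq` ∕ `rg_time_unique`: THE SMALL BOX IS ONE FORWARD ORBIT OF THE REFERENCE PIN, and the Λ-coordinate IS the renormalization-group time from it), the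
# backward orbit `φ_{−s} g` stays in the small box exactly for `s ≤ T(g)` (`backward_time_le_iff`, `no_preimage_of_lt`: THE INFRARED EDGE), and along integer backward
# times `φ_1 ∘ φ_{−(k+1)} = φ_{−k}` (`rg_one_rg_neg_succ`).  §85, FOR THE FLOW WITH MEMORY (from ONE AF reference and part 14's package at e′, Λ any dynamical Abel function):
# the flow `1∕h(m+1)² = 1∕h(m)² + B(h(m+1), h(m+2), …)` is IMPLICIT towards the ultraviolet but EXPLICIT towards the infrared — prepending
# **`x = 1∕√(1∕e² − B(h))`** to a box solution h from e gives a solution from x (`prepend_memFlow`) —, so THE INVERSE RENORMALIZATION STEP IS EXPLICIT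
# (**`inverse_step_explicit`**: if `Λ e ≥ Λ e′ + β₀` then `φ_{−1} e = 1∕√(1∕e² − B(h))` with `1∕e² − B(h) > 0`, the solution from `φ_{−1} e` is h prepended by it, and
# `R(φ_{−1} e) = e`), obeys the STEP-SCALING ESTIMATE **`|1∕(φ_{−1} e)² − (1∕e² − β₀)| ≤ C_m e∕(1 − θ)`** (`abs_inverse_step_chart_sub_le` — the lattice step-scaling
# function «σ(u) at scale L from u at scale 1» of the flow with memory is one-loop with an O(e) defect read off the memory profile alone), iterates
# (`backward_orbit_succ`: `1∕x_{k+1}² = 1∕x_k² − B(solution from x_k)` as long as `(k+1)β₀ ≤ Λ e − Λ e′`), and STOPS AT THE INFRARED EDGE OF THE SMALL BOX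
# (`backward_exit`: once `Λ e − Λ e′ < (k+1)β₀` the k-th backward point has NO preimage under the renormalization step inside ]0, e′]).  RG time is a cocycle
# along trajectories: `T(h k) = T(e) + k` (`rg_time_solution`).
# Abstract in B (β-flow team, prover 1 = recursion ∕ upper ∕ bare-coupling ∕ uniqueness side, unit `b2b-balaban-beta-bflow-p1`, gen 41; ROW AP-I·Uc × NODE U2 — negative
# times, over part 46 `…ShiftFlowZeroSemigroup` (`rg_mem_eq`), part 44 `…ShiftFlowZeroIsometry` (`dynAbel_shift`), part 13 `…ShiftFlowPicardLimit` (THE solution near zero pin),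
# part 34 `…ShiftFlowZeroOffset` (`package_of_le`, `succ_le_of_reference_flow`), part 32 `…ShiftFlowZero` (`tsum_weighted_le`))

HONEST FRAMING (page 1 of everything the β sub-cell writes): discharging `BetaPertH` makes Bałaban's UV stability UNCONDITIONAL — a
real constructive-QFT result; it is NOT the continuum limit and NOT the Clay problem.  HONEST DEPENDENCY (cell reorg 2026-08-19,
verbatim): «continuum YM on T⁴ ⇐ BetaPertH ∧ nine spine estimates (0/9 proved); BetaPertH ⇐ (D1) ∧ (D4) ∧ CAP+tail; G-an2-4 gates
asym, D1 and NE2/3/4.»  THIS MODULE DISCHARGES NOTHING: elementary real analysis (left inverses of a strictly monotone map, one explicit square root) over node U2's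
HYPOTHESIS SHAPES `T4BetaStationary.{SeqBox, MemoryProfile}`, `T4BetaFlowWellPosed.{MemFlow, solution}` on an ABSTRACT functional `B`; parts 13 ∕ 32 ∕ 34 ∕ 44 ∕ 46 BY NAME —
nothing restated.  `ScaleShiftRate` (GAPS G-t4-U2-1), `HistLipschitz`∕`FadingMemory` (G-t4-U2-2) and [I] THEOREM 2 (p. 259, STATED WITHOUT PROOF) do not occur in this
abstract part; NOTHING is asserted about Bałaban's actual β.  «Step-scaling function», «infrared edge», «RG time» are OUR READING (the lattice step-scaling function of
Lüscher–Weisz–Wolff is the analogue; nothing of it is imported or claimed).  [I] = T. Bałaban, Commun. Math. Phys. **109** (1987) 249–301 [Balaban1987RG1]: Thm 2 (0.31)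
p. 259 (the β-functions converge to a history functional), (0.18)–(0.20) pp. 255–256 (the recursion), §5 p. 298.

WHAT THIS FILE PROVES (0 sorry, 0 def): §84 (abstract) `rg_mem_eq_of_le`, `backward_time_le_iff`, **`rg_add_of_le`**, **`rg_neg_rg`**, `rg_rg_neg`, `rg_time_nonneg`,
**`rg_time_eq`**, `rg_time_unique`, **`no_preimage_of_lt`**, `rg_one_rg_neg_succ`; §85 (flow) `prepend_memFlow`, `prepend_seqBox`, **`inverse_step_explicit`**,
**`abs_inverse_step_chart_sub_le`**, **`backward_orbit_succ`**, **`backward_exit`**, `rg_time_solution`.  NOT CLAIMED: that the backward continuation stays in the BIG box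
]0, γ] beyond the small one (outside ]0, e′] uniqueness of box solutions is not available and `φ` is not defined); anything about Bałaban's β; `BetaPertH`; continuum; Clay.
-/

namespace Summit.QuantumFields.BalabanUV.Beta.EriceFlowEnclosureB12AsPrintedHistoryContagionShiftFlowZeroSemigroupBackward

open Filter Topology Set Function
open Literature.MathematicalPhysics.QuantumFieldTheory.Balaban1983to89
open Literature.MathematicalPhysics.QuantumFieldTheory.Balaban1983to89.T4BetaStationary (SeqBox MemoryProfile)
open Literature.MathematicalPhysics.QuantumFieldTheory.Balaban1983to89.T4BetaFlowWellPosed (MemFlow solution seqBox_shift one_div_sqrt_one_div_sq)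
open Summit.QuantumFields.BalabanUV.Beta.EriceRemainderEnclosureHistoryAutonomyOrder (memFlow_tail)
open Summit.QuantumFields.BalabanUV.Beta.EriceFlowEnclosureB12AsPrintedHistoryContagionShiftFlowPicardLimit (memFlow_solution_of_reference
  eq_solution_of_memFlow_of_reference)
open Summit.QuantumFields.BalabanUV.Beta.EriceFlowEnclosureB12AsPrintedHistoryContagionShiftFlowZero (tsum_weighted_le)
open Summit.QuantumFields.BalabanUV.Beta.EriceFlowEnclosureB12AsPrintedHistoryContagionShiftFlowZeroOffset (package_of_le succ_le_of_reference_flow)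
open Summit.QuantumFields.BalabanUV.Beta.EriceFlowEnclosureB12AsPrintedHistoryContagionShiftFlowZeroIsometry (dynAbel_shift)
open Summit.QuantumFields.BalabanUV.Beta.EriceFlowEnclosureB12AsPrintedHistoryContagionShiftFlowZeroSemigroup (rg_mem_eq)

noncomputable section

/-! ## §84 Negative times of the continuous renormalization group (abstract: any strictly antitone Λ on ]0, e′] onto `[Λ e′, ∞[`) -/

variable {Λ : ℝ → ℝ} {e' β₀ : ℝ}

/-- **THE TIME-s MAP FOR ANY REAL TIME**: whenever `Λ e′ ≤ Λ g + sβ₀` (no sign condition on s), `φ_s g := invFunOn Λ (Ioc 0 e′) (Λ g + sβ₀)` lies in ]0, e′] and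
`Λ(φ_s g) = Λ g + sβ₀`.  (Part 46's `rg_mem_eq` is the case `s ≥ 0`, where the condition is automatic.) [folklore; Szekeres 1958] -/
theorem rg_mem_eq_of_le (honto : ∀ y : ℝ, Λ e' ≤ y → ∃ x ∈ Ioc (0 : ℝ) e', Λ x = y) {g s : ℝ} (hle : Λ e' ≤ Λ g + s * β₀) :
    invFunOn Λ (Ioc 0 e') (Λ g + s * β₀) ∈ Ioc (0 : ℝ) e' ∧ Λ (invFunOn Λ (Ioc 0 e') (Λ g + s * β₀)) = Λ g + s * β₀ :=
  ⟨invFunOn_mem (honto _ hle), invFunOn_eq (honto _ hle)⟩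

/-- The domain of the backward time −s at g: `Λ e′ ≤ Λ g − sβ₀ ⟺ s ≤ T(g) := (Λ g − Λ e′)∕β₀`. [folklore] -/
theorem backward_time_le_iff (hβ₀ : 0 < β₀) {g s : ℝ} : Λ e' ≤ Λ g + -s * β₀ ↔ s ≤ (Λ g - Λ e') / β₀ := by
  rw [le_div_iff₀ hβ₀]
  constructor <;> intro h <;> linarith

/-- **THE LOCAL GROUP LAW** `φ_{s+s′} = φ_s ∘ φ_{s′}` for real times, wherever both sides are defined (`Λ e′ ≤ Λ g + s′β₀` and `Λ e′ ≤ Λ g + (s + s′)β₀`). [folklore; Szekeres 1958] -/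
theorem rg_add_of_le (hanti : StrictAntiOn Λ (Ioc 0 e')) (honto : ∀ y : ℝ, Λ e' ≤ y → ∃ x ∈ Ioc (0 : ℝ) e', Λ x = y)
    {g s s' : ℝ} (h1 : Λ e' ≤ Λ g + s' * β₀) (h2 : Λ e' ≤ Λ g + (s + s') * β₀) :
    invFunOn Λ (Ioc 0 e') (Λ g + (s + s') * β₀) = invFunOn Λ (Ioc 0 e') (Λ (invFunOn Λ (Ioc 0 e') (Λ g + s' * β₀)) + s * β₀) := by
  obtain ⟨m₁, e₁⟩ := rg_mem_eq_of_le honto h2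
  obtain ⟨-, e₂⟩ := rg_mem_eq_of_le honto h1
  have h3 : Λ e' ≤ Λ (invFunOn Λ (Ioc 0 e') (Λ g + s' * β₀)) + s * β₀ := by rw [e₂]; linarith
  obtain ⟨m₃, e₃⟩ := rg_mem_eq_of_le honto h3
  exact ((hanti.eq_iff_eq m₁ m₃).mp (by rw [e₁, e₃, e₂]; ring)).symm

/-- **`φ_{−s} ∘ φ_s = id`**: the continuous renormalization group is inverted explicitly — for `g ∈ ]0, e′]` and any real s with `Λ e′ ≤ Λ g + sβ₀`,
`φ_{−s}(φ_s g) = g`. [folklore] -/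
theorem rg_neg_rg (hanti : StrictAntiOn Λ (Ioc 0 e')) (honto : ∀ y : ℝ, Λ e' ≤ y → ∃ x ∈ Ioc (0 : ℝ) e', Λ x = y)
    {g s : ℝ} (hg : g ∈ Ioc (0 : ℝ) e') (hle : Λ e' ≤ Λ g + s * β₀) :
    invFunOn Λ (Ioc 0 e') (Λ (invFunOn Λ (Ioc 0 e') (Λ g + s * β₀)) + -s * β₀) = g := by
  obtain ⟨-, e₁⟩ := rg_mem_eq_of_le honto hle
  rw [e₁, show Λ g + s * β₀ + -s * β₀ = Λ g by ring]
  exact hanti.injOn.leftInvOn_invFunOn hg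

/-- **`φ_s ∘ φ_{−s} = id`** where the backward point is defined (`Λ e′ ≤ Λ g − sβ₀`). [folklore] -/
theorem rg_rg_neg (hanti : StrictAntiOn Λ (Ioc 0 e')) (honto : ∀ y : ℝ, Λ e' ≤ y → ∃ x ∈ Ioc (0 : ℝ) e', Λ x = y)
    {g s : ℝ} (hg : g ∈ Ioc (0 : ℝ) e') (hle : Λ e' ≤ Λ g + -s * β₀) :
    invFunOn Λ (Ioc 0 e') (Λ (invFunOn Λ (Ioc 0 e') (Λ g + -s * β₀)) + s * β₀) = g := by
  have := rg_neg_rg hanti honto hg hle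
  rwa [neg_neg] at this

/-- The RG time of a coupling of the small box is non-negative: `0 ≤ T(g) = (Λ g − Λ e′)∕β₀`. [folklore] -/
theorem rg_time_nonneg (hanti : StrictAntiOn Λ (Ioc 0 e')) (hβ₀ : 0 < β₀) {g : ℝ} (hg : g ∈ Ioc (0 : ℝ) e') : 0 ≤ (Λ g - Λ e') / β₀ := by
  have he' : e' ∈ Ioc (0 : ℝ) e' := ⟨hg.1.trans_le hg.2, le_rfl⟩
  have h1 : Λ e' ≤ Λ g := hanti.antitoneOn hg he' hg.2
  exact div_nonneg (by linarith) hβ₀.le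

/-- **THE SMALL BOX IS ONE FORWARD ORBIT OF THE REFERENCE PIN**: every `g ∈ ]0, e′]` is `g = φ_{T(g)}(e′)` with `T(g) = (Λ g − Λ e′)∕β₀ ≥ 0` — the Λ-coordinate,
in units of β₀, IS the renormalization-group time elapsed from the reference pin. [folklore] -/
theorem rg_time_eq (hanti : StrictAntiOn Λ (Ioc 0 e')) (hβ₀ : 0 < β₀) {g : ℝ} (hg : g ∈ Ioc (0 : ℝ) e') :
    invFunOn Λ (Ioc 0 e') (Λ e' + (Λ g - Λ e') / β₀ * β₀) = g := by
  rw [div_mul_cancel₀ (Λ g - Λ e') hβ₀.ne', show Λ e' + (Λ g - Λ e') = Λ g by ring]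
  exact hanti.injOn.leftInvOn_invFunOn hg

/-- … and the time is UNIQUE: if `φ_s(e′) = g` for some `s ≥ 0` then `s = T(g)`. [folklore] -/
theorem rg_time_unique (hanti : StrictAntiOn Λ (Ioc 0 e')) (honto : ∀ y : ℝ, Λ e' ≤ y → ∃ x ∈ Ioc (0 : ℝ) e', Λ x = y) (hβ₀ : 0 < β₀)
    {g s : ℝ} (hg : g ∈ Ioc (0 : ℝ) e') (hs : 0 ≤ s) (hsg : invFunOn Λ (Ioc 0 e') (Λ e' + s * β₀) = g) : s = (Λ g - Λ e') / β₀ := by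
  have he' : e' ∈ Ioc (0 : ℝ) e' := ⟨hg.1.trans_le hg.2, le_rfl⟩
  obtain ⟨-, e₁⟩ := rg_mem_eq hanti honto hβ₀.le he' hs
  rw [hsg] at e₁
  rw [e₁, eq_div_iff hβ₀.ne']; ring

/-- **THE INFRARED EDGE OF THE SMALL BOX**: for a backward time `s > T(g)` NO coupling of ]0, e′] has the Λ-value `Λ g − sβ₀` — the backward orbit of g leaves the small
box exactly at time T(g) (beyond it the coupling, if it exists at all in the big box, exceeds e′, where trajectories need not be unique). [folklore] -/
theorem no_preimage_of_lt (hanti : StrictAntiOn Λ (Ioc 0 e')) (hβ₀ : 0 < β₀) {g s : ℝ} (hg : g ∈ Ioc (0 : ℝ) e') (hs : (Λ g - Λ e') / β₀ < s) :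
    ∀ x ∈ Ioc (0 : ℝ) e', Λ x ≠ Λ g + -s * β₀ := by
  intro x hx hΛx
  have he' : e' ∈ Ioc (0 : ℝ) e' := ⟨hg.1.trans_le hg.2, le_rfl⟩
  have h1 : Λ e' ≤ Λ x := hanti.antitoneOn hx he' hx.2
  rw [div_lt_iff₀ hβ₀] at hs
  linarith

/-- Along integer backward times the renormalization step climbs back: `φ_1(φ_{−(k+1)} g) = φ_{−k} g` whenever `(k+1)β₀ ≤ Λ g − Λ e′`. [folklore] -/
theorem rg_one_rg_neg_succ (hanti : StrictAntiOn Λ (Ioc 0 e')) (honto : ∀ y : ℝ, Λ e' ≤ y → ∃ x ∈ Ioc (0 : ℝ) e', Λ x = y) (hβ₀ : 0 ≤ β₀)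
    {g : ℝ} {k : ℕ} (hk : ((k : ℝ) + 1) * β₀ ≤ Λ g - Λ e') :
    invFunOn Λ (Ioc 0 e') (Λ (invFunOn Λ (Ioc 0 e') (Λ g + -((k : ℝ) + 1) * β₀)) + 1 * β₀) = invFunOn Λ (Ioc 0 e') (Λ g + -(k : ℝ) * β₀) := by
  have h1 : Λ e' ≤ Λ g + -((k : ℝ) + 1) * β₀ := by linarith
  have h2 : Λ e' ≤ Λ g + (1 + -((k : ℝ) + 1)) * β₀ := by nlinarith
  have := rg_add_of_le hanti honto h1 h2
  rw [show (1 + -((k : ℝ) + 1)) = -(k : ℝ) by ring] at this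
  exact this.symm

/-! ## §85 For the flow with memory: the inverse renormalization step is explicit -/

/-- **PREPENDING**: the flow with memory is EXPLICIT towards the infrared.  If h solves the flow from e (`h 0 = e`) and x satisfies `1∕e² = 1∕x² + B(h)`, then the
sequence `h⁻ = (x, h 0, h 1, …)` solves the flow from x. [folklore] -/
theorem prepend_memFlow {B : (ℕ → ℝ) → ℝ} {e x : ℝ} {h hm : ℕ → ℝ} (hhf : MemFlow B e h) (hm0 : hm 0 = x) (hms : ∀ k, hm (k + 1) = h k)
    (hx : 1 / e ^ 2 = 1 / x ^ 2 + B h) : MemFlow B x hm := by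
  refine ⟨hm0, fun m => ?_⟩
  cases m with
  | zero =>
    have htail : (fun j => hm (0 + 1 + j)) = h := funext fun j => by rw [zero_add, add_comm]; exact hms j
    rw [htail, zero_add, hms 0, hm0, hhf.1]
    exact hx
  | succ k =>
    have htail : (fun j => hm (k + 1 + 1 + j)) = fun j => h (k + 1 + j) :=
      funext fun j => by rw [show k + 1 + 1 + j = (k + 1 + j) + 1 by ring]; exact hms _
    rw [htail, hms (k + 1), hms k]
    exact hhf.2 k

/-- The prepended sequence stays in the box when the new infrared point does. [folklore] -/
theorem prepend_seqBox {γ x : ℝ} {h hm : ℕ → ℝ} (hhs : SeqBox γ h) (hm0 : hm 0 = x) (hms : ∀ k, hm (k + 1) = h k) (hx0 : 0 < x) (hxγ : x ≤ γ) :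
    SeqBox γ hm := by
  intro j
  cases j with
  | zero => rw [hm0]; exact ⟨hx0, hxγ⟩
  | succ k => rw [hms k]; exact hhs k

/-- **THE INVERSE RENORMALIZATION STEP IS EXPLICIT.**  `B` with memory profile `(C_m, θ)` on ]0, γ]^ℕ and the value β₀ at the zero history; ONE AF reference t; part 14's
package at the reference pin e′; Λ ANY dynamical Abel function (comparison sequence a), strictly antitone on ]0, e′] onto `[Λ e′, ∞[`.  Let `e ∈ ]0, e′]` with box solution h
and **`Λ e′ + β₀ ≤ Λ e`** (one backward step stays in the small box), and `x := φ_{−1} e = invFunOn Λ (Ioc 0 e′) (Λ e − β₀)`.  THEN: (i) `x ∈ ]0, e′]`; (ii) `R x = e` — the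
solution from x passes through e after ONE step; (iii) the solution from x is h PREPENDED by x (`solution B x (k+1) = h k`); (iv) `1∕e² − B(h) > 0` and
**`x = 1∕√(1∕e² − B(h))`**.  The implicit flow with memory has an explicit inverse: to go one scale towards the infrared, subtract the functional's value on the known
ultraviolet history. [cite: Balaban1987RG1, Thm 2 (0.31) p.259 with (0.18)–(0.20) pp.255–256] -/
theorem inverse_step_explicit {B : (ℕ → ℝ) → ℝ} {Cm θ γ β₀ bs ta gs e' e : ℝ} {t h : ℕ → ℝ} {a : ℕ → ℝ} {Λ : ℝ → ℝ}
    (hB : MemoryProfile Cm θ γ B) (hCm : 0 ≤ Cm) (hθ0 : 0 ≤ θ) (hθ1 : θ < 1) (hbs : 0 < bs) (hta : 0 < ta)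
    (h0 : ∀ u : ℕ → ℝ, SeqBox γ u → |B u - β₀| ≤ Cm * ∑' j, θ ^ j * u j)
    (hts : SeqBox γ t) (htf : MemFlow B gs t) (hprof : ∀ m : ℕ, 1 / ta ^ 2 + bs * (m : ℝ) ≤ 1 / (t m) ^ 2)
    (hΛ : ∀ e ∈ Ioc (0 : ℝ) e', ∀ h : ℕ → ℝ, SeqBox γ h → MemFlow B e h → Tendsto (fun n => 1 / h n ^ 2 - a n) atTop (𝓝 (Λ e)))
    (hanti : StrictAntiOn Λ (Ioc 0 e')) (honto : ∀ y : ℝ, Λ e' ≤ y → ∃ x ∈ Ioc (0 : ℝ) e', Λ x = y)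
    (h2e' : 2 * e' ≤ γ)
    (hs1 : 4 * Cm * e' ≤ bs * (1 - θ))
    (hs2 : e' ^ 2 * (1 / gs ^ 2 + Cm * γ / (1 - θ) ^ 2 + (2 * Cm / ((1 - θ) * bs)) ^ 2) ≤ 3 / 4)
    (hs4 : 64 * Cm * e' ^ 3 ≤ (1 - θ) ^ 2) (hs5 : Cm * (8 * e' ^ 3 + 16 * e' / bs) ≤ (1 - θ) / 4)
    (he : e ∈ Ioc (0 : ℝ) e') (hhs : SeqBox γ h) (hhf : MemFlow B e h) (hback : Λ e' + β₀ ≤ Λ e) :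
    invFunOn Λ (Ioc 0 e') (Λ e + -1 * β₀) ∈ Ioc (0 : ℝ) e' ∧
      solution B (invFunOn Λ (Ioc 0 e') (Λ e + -1 * β₀)) 1 = e ∧
      (∀ k : ℕ, solution B (invFunOn Λ (Ioc 0 e') (Λ e + -1 * β₀)) (k + 1) = h k) ∧
      0 < 1 / e ^ 2 - B h ∧ invFunOn Λ (Ioc 0 e') (Λ e + -1 * β₀) = 1 / Real.sqrt (1 / e ^ 2 - B h) := by
  have hγ : 0 ≤ γ := by linarith [he.1, he.2]
  set x := invFunOn Λ (Ioc 0 e') (Λ e + -1 * β₀) with hxdef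
  obtain ⟨hx, hΛx⟩ : x ∈ Ioc (0 : ℝ) e' ∧ Λ x = Λ e + -1 * β₀ := rg_mem_eq_of_le honto (by linarith)
  -- THE solution from x and from e
  obtain ⟨p1, p2, p4, -⟩ := package_of_le hCm hθ1 hbs hγ hx.1 hx.2 hs1 hs2 hs4 hs5
  obtain ⟨hxs, hxf, -, -⟩ := memFlow_solution_of_reference hB hCm hθ0 hθ1 hbs hta hts htf hprof hx.1 (by linarith [hx.2]) p1 p2 p4
  obtain ⟨q1, q2, q4, -⟩ := package_of_le hCm hθ1 hbs hγ he.1 he.2 hs1 hs2 hs4 hs5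
  have hhe : h = solution B e := eq_solution_of_memFlow_of_reference hB hCm hθ0 hθ1 hbs hta hts htf hprof he.1 (by linarith [he.2]) q1 q2 q4 hhs hhf
  -- Abel along the solution from x: its first step has the Λ-value of e
  have hab : Λ (solution B x 1) = Λ x + ((1 : ℕ) : ℝ) * β₀ :=
    dynAbel_shift hB hCm hθ0 hθ1 hbs hta h0 hts htf hprof hΛ hx hxs hxf p1 p2 1
  have h1mem : solution B x 1 ∈ Ioc (0 : ℝ) e' := by
    refine ⟨(hxs 1).1, ?_⟩
    have := (succ_le_of_reference_flow hB hCm hθ0 hθ1 hbs hta h0 hts htf hprof hxs hxf p1 p2 1).2.2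
    exact this.trans hx.2
  have hR : solution B x 1 = e := ((hanti.eq_iff_eq h1mem he).mp (by rw [hab, hΛx]; push_cast; ring)).symm
  -- the tail of the solution from x is THE solution from e
  have htail : (fun j => solution B x (1 + j)) = h := by
    have hts' : SeqBox γ (fun j => solution B x (1 + j)) := seqBox_shift hxs 1
    have htf' : MemFlow B e (fun j => solution B x (1 + j)) := by
      have := memFlow_tail hxf 1
      rwa [hR] at this
    rw [hhe]
    exact eq_solution_of_memFlow_of_reference hB hCm hθ0 hθ1 hbs hta hts htf hprof he.1 (by linarith [he.2]) q1 q2 q4 hts' htf'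
  have hk : ∀ k : ℕ, solution B x (k + 1) = h k := fun k => by
    have := congrFun htail k
    simpa only [add_comm] using this
  -- the first step of the flow from x, read backwards
  have hstep : 1 / e ^ 2 = 1 / x ^ 2 + B h := by
    have h01 := hxf.2 0
    rw [zero_add, hR, hxf.1] at h01
    rwa [show (fun j => solution B x (1 + j)) = h from htail] at h01
  have hpos : 0 < 1 / e ^ 2 - B h := by
    have : 0 < 1 / x ^ 2 := by have := hx.1; positivity
    linarith
  refine ⟨hx, hR, hk, hpos, ?_⟩
  have : 1 / x ^ 2 = 1 / e ^ 2 - B h := by linarith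
  rw [← this]
  exact (one_div_sqrt_one_div_sq hx.1).symm

/-- **THE STEP-SCALING ESTIMATE**: in the setting of `inverse_step_explicit`, **`|1∕(φ_{−1} e)² − (1∕e² − β₀)| ≤ C_m·e∕(1 − θ)`** — one inverse renormalization step lowers
the chart coordinate by β₀ up to a defect of first order in the coupling, read off the memory profile against the zero history (the solution from e is an ]0, e]-valued
history). [cite: Balaban1987RG1, Thm 2 (0.31) p.259 with (0.18)–(0.20) pp.255–256] -/
theorem abs_inverse_step_chart_sub_le {B : (ℕ → ℝ) → ℝ} {Cm θ γ β₀ bs ta gs e' e : ℝ} {t h : ℕ → ℝ} {a : ℕ → ℝ} {Λ : ℝ → ℝ}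
    (hB : MemoryProfile Cm θ γ B) (hCm : 0 ≤ Cm) (hθ0 : 0 ≤ θ) (hθ1 : θ < 1) (hbs : 0 < bs) (hta : 0 < ta)
    (h0 : ∀ u : ℕ → ℝ, SeqBox γ u → |B u - β₀| ≤ Cm * ∑' j, θ ^ j * u j)
    (hts : SeqBox γ t) (htf : MemFlow B gs t) (hprof : ∀ m : ℕ, 1 / ta ^ 2 + bs * (m : ℝ) ≤ 1 / (t m) ^ 2)
    (hΛ : ∀ e ∈ Ioc (0 : ℝ) e', ∀ h : ℕ → ℝ, SeqBox γ h → MemFlow B e h → Tendsto (fun n => 1 / h n ^ 2 - a n) atTop (𝓝 (Λ e)))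
    (hanti : StrictAntiOn Λ (Ioc 0 e')) (honto : ∀ y : ℝ, Λ e' ≤ y → ∃ x ∈ Ioc (0 : ℝ) e', Λ x = y)
    (h2e' : 2 * e' ≤ γ)
    (hs1 : 4 * Cm * e' ≤ bs * (1 - θ))
    (hs2 : e' ^ 2 * (1 / gs ^ 2 + Cm * γ / (1 - θ) ^ 2 + (2 * Cm / ((1 - θ) * bs)) ^ 2) ≤ 3 / 4)
    (hs4 : 64 * Cm * e' ^ 3 ≤ (1 - θ) ^ 2) (hs5 : Cm * (8 * e' ^ 3 + 16 * e' / bs) ≤ (1 - θ) / 4)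
    (he : e ∈ Ioc (0 : ℝ) e') (hhs : SeqBox γ h) (hhf : MemFlow B e h) (hback : Λ e' + β₀ ≤ Λ e) :
    |1 / invFunOn Λ (Ioc 0 e') (Λ e + -1 * β₀) ^ 2 - (1 / e ^ 2 - β₀)| ≤ Cm * e / (1 - θ) := by
  have hγ : 0 ≤ γ := by linarith [he.1, he.2]
  obtain ⟨-, -, -, hpos, hx⟩ := inverse_step_explicit hB hCm hθ0 hθ1 hbs hta h0 hts htf hprof hΛ hanti honto h2e' hs1 hs2 hs4 hs5 he hhs hhf hback
  rw [hx, T4BetaFlowWellPosed.one_div_sq_one_div_sqrt hpos]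
  -- the solution from e is an ]0, e]-valued history
  obtain ⟨q1, q2, -, -⟩ := package_of_le hCm hθ1 hbs hγ he.1 he.2 hs1 hs2 hs4 hs5
  have hbox : SeqBox e h := fun j =>
    ⟨(hhs j).1, (succ_le_of_reference_flow hB hCm hθ0 hθ1 hbs hta h0 hts htf hprof hhs hhf q1 q2 j).2.2⟩
  have h1 := h0 h hhs
  have h2 : ∑' j, θ ^ j * h j ≤ e / (1 - θ) := tsum_weighted_le hθ0 hθ1 hbox
  rw [show 1 / e ^ 2 - B h - (1 / e ^ 2 - β₀) = -(B h - β₀) by ring, abs_neg]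
  calc |B h - β₀| ≤ Cm * ∑' j, θ ^ j * h j := h1
    _ ≤ Cm * (e / (1 - θ)) := mul_le_mul_of_nonneg_left h2 hCm
    _ = Cm * e / (1 - θ) := by ring

/-- **THE BACKWARD ORBIT ITERATES THE EXPLICIT INVERSE STEP**: with `x_k := φ_{−k} e`, as long as `(k+1)β₀ ≤ Λ e − Λ e′`: `x_{k+1} ∈ ]0, e′]`, `R x_{k+1} = x_k`, and
**`1∕x_{k+1}² = 1∕x_k² − B(solution B x_k)`** — the infrared continuation of the trajectory through e, one explicit square root per scale. [cite: Balaban1987RG1, Thm 2 (0.31) p.259 with (0.18)–(0.20) pp.255–256] -/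
theorem backward_orbit_succ {B : (ℕ → ℝ) → ℝ} {Cm θ γ β₀ bs ta gs e' e : ℝ} {t : ℕ → ℝ} {a : ℕ → ℝ} {Λ : ℝ → ℝ}
    (hB : MemoryProfile Cm θ γ B) (hCm : 0 ≤ Cm) (hθ0 : 0 ≤ θ) (hθ1 : θ < 1) (hbs : 0 < bs) (hta : 0 < ta)
    (h0 : ∀ u : ℕ → ℝ, SeqBox γ u → |B u - β₀| ≤ Cm * ∑' j, θ ^ j * u j)
    (hts : SeqBox γ t) (htf : MemFlow B gs t) (hprof : ∀ m : ℕ, 1 / ta ^ 2 + bs * (m : ℝ) ≤ 1 / (t m) ^ 2)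
    (hΛ : ∀ e ∈ Ioc (0 : ℝ) e', ∀ h : ℕ → ℝ, SeqBox γ h → MemFlow B e h → Tendsto (fun n => 1 / h n ^ 2 - a n) atTop (𝓝 (Λ e)))
    (hanti : StrictAntiOn Λ (Ioc 0 e')) (honto : ∀ y : ℝ, Λ e' ≤ y → ∃ x ∈ Ioc (0 : ℝ) e', Λ x = y) (hβ₀ : 0 ≤ β₀)
    (h2e' : 2 * e' ≤ γ)
    (hs1 : 4 * Cm * e' ≤ bs * (1 - θ))
    (hs2 : e' ^ 2 * (1 / gs ^ 2 + Cm * γ / (1 - θ) ^ 2 + (2 * Cm / ((1 - θ) * bs)) ^ 2) ≤ 3 / 4)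
    (hs4 : 64 * Cm * e' ^ 3 ≤ (1 - θ) ^ 2) (hs5 : Cm * (8 * e' ^ 3 + 16 * e' / bs) ≤ (1 - θ) / 4)
    (he : e ∈ Ioc (0 : ℝ) e') {k : ℕ} (hk : ((k : ℝ) + 1) * β₀ ≤ Λ e - Λ e') :
    invFunOn Λ (Ioc 0 e') (Λ e + -((k : ℝ) + 1) * β₀) ∈ Ioc (0 : ℝ) e' ∧
      solution B (invFunOn Λ (Ioc 0 e') (Λ e + -((k : ℝ) + 1) * β₀)) 1 = invFunOn Λ (Ioc 0 e') (Λ e + -(k : ℝ) * β₀) ∧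
      1 / invFunOn Λ (Ioc 0 e') (Λ e + -((k : ℝ) + 1) * β₀) ^ 2
        = 1 / invFunOn Λ (Ioc 0 e') (Λ e + -(k : ℝ) * β₀) ^ 2 - B (solution B (invFunOn Λ (Ioc 0 e') (Λ e + -(k : ℝ) * β₀))) := by
  have hγ : 0 ≤ γ := by linarith [he.1, he.2]
  -- the k-th backward point and THE solution from it
  have hk0 : Λ e' ≤ Λ e + -(k : ℝ) * β₀ := by nlinarith
  obtain ⟨hxk, hΛxk⟩ := rg_mem_eq_of_le honto hk0
  set xk := invFunOn Λ (Ioc 0 e') (Λ e + -(k : ℝ) * β₀) with hxkdef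
  obtain ⟨p1, p2, p4, -⟩ := package_of_le hCm hθ1 hbs hγ hxk.1 hxk.2 hs1 hs2 hs4 hs5
  obtain ⟨hxs, hxf, -, -⟩ := memFlow_solution_of_reference hB hCm hθ0 hθ1 hbs hta hts htf hprof hxk.1 (by linarith [hxk.2]) p1 p2 p4
  have hback : Λ e' + β₀ ≤ Λ xk := by rw [hΛxk]; linarith
  obtain ⟨hx, hR, -, hpos, hexp⟩ :=
    inverse_step_explicit hB hCm hθ0 hθ1 hbs hta h0 hts htf hprof hΛ hanti honto h2e' hs1 hs2 hs4 hs5 hxk hxs hxf hback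
  -- `φ_{−1} x_k = φ_{−(k+1)} e` by the local group law
  have hgl : invFunOn Λ (Ioc 0 e') (Λ xk + -1 * β₀) = invFunOn Λ (Ioc 0 e') (Λ e + -((k : ℝ) + 1) * β₀) := by
    have h2 : Λ e' ≤ Λ e + (-1 + -(k : ℝ)) * β₀ := by linarith
    have := rg_add_of_le hanti honto hk0 h2
    rw [show (-1 + -(k : ℝ)) = -((k : ℝ) + 1) by ring] at this
    exact this.symm
  rw [← hgl]
  refine ⟨hx, hR, ?_⟩
  rw [hexp, T4BetaFlowWellPosed.one_div_sq_one_div_sqrt hpos]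

/-- **THE INFRARED EDGE**: once `Λ e − Λ e′ < (k+1)β₀`, the k-th backward point `x_k = φ_{−k} e` (defined for `kβ₀ ≤ Λ e − Λ e′`) has NO preimage under the
renormalization step inside the small box: no `x ∈ ]0, e′]` with `R x = x_k`.  The infrared continuation of the trajectory through e inside ]0, e′] consists of EXACTLY
the backward points `x_0 = e, x_1, …, x_N`, `Nβ₀ ≤ Λ e − Λ e′ < (N+1)β₀`. [cite: Balaban1987RG1, Thm 2 (0.31) p.259 with (0.18)–(0.20) pp.255–256] -/
theorem backward_exit {B : (ℕ → ℝ) → ℝ} {Cm θ γ β₀ bs ta gs e' e : ℝ} {t : ℕ → ℝ} {a : ℕ → ℝ} {Λ : ℝ → ℝ}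
    (hB : MemoryProfile Cm θ γ B) (hCm : 0 ≤ Cm) (hθ0 : 0 ≤ θ) (hθ1 : θ < 1) (hbs : 0 < bs) (hta : 0 < ta)
    (h0 : ∀ u : ℕ → ℝ, SeqBox γ u → |B u - β₀| ≤ Cm * ∑' j, θ ^ j * u j)
    (hts : SeqBox γ t) (htf : MemFlow B gs t) (hprof : ∀ m : ℕ, 1 / ta ^ 2 + bs * (m : ℝ) ≤ 1 / (t m) ^ 2)
    (hΛ : ∀ e ∈ Ioc (0 : ℝ) e', ∀ h : ℕ → ℝ, SeqBox γ h → MemFlow B e h → Tendsto (fun n => 1 / h n ^ 2 - a n) atTop (𝓝 (Λ e)))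
    (hanti : StrictAntiOn Λ (Ioc 0 e')) (honto : ∀ y : ℝ, Λ e' ≤ y → ∃ x ∈ Ioc (0 : ℝ) e', Λ x = y)
    (h2e' : 2 * e' ≤ γ)
    (hs1 : 4 * Cm * e' ≤ bs * (1 - θ))
    (hs2 : e' ^ 2 * (1 / gs ^ 2 + Cm * γ / (1 - θ) ^ 2 + (2 * Cm / ((1 - θ) * bs)) ^ 2) ≤ 3 / 4)
    (hs4 : 64 * Cm * e' ^ 3 ≤ (1 - θ) ^ 2) (hs5 : Cm * (8 * e' ^ 3 + 16 * e' / bs) ≤ (1 - θ) / 4)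
    {k : ℕ} (hk : (k : ℝ) * β₀ ≤ Λ e - Λ e') (hedge : Λ e - Λ e' < ((k : ℝ) + 1) * β₀) :
    invFunOn Λ (Ioc 0 e') (Λ e + -(k : ℝ) * β₀) ∈ Ioc (0 : ℝ) e' ∧
      ∀ x ∈ Ioc (0 : ℝ) e', SeqBox γ (solution B x) → MemFlow B x (solution B x) →
        solution B x 1 ≠ invFunOn Λ (Ioc 0 e') (Λ e + -(k : ℝ) * β₀) := by
  have hk0 : Λ e' ≤ Λ e + -(k : ℝ) * β₀ := by linarith
  obtain ⟨hxk, hΛxk⟩ := rg_mem_eq_of_le honto hk0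
  have hγ : 0 ≤ γ := by linarith [hxk.1, hxk.2]
  refine ⟨hxk, fun x hx hxs hxf hRx => ?_⟩
  obtain ⟨p1, p2, -, -⟩ := package_of_le hCm hθ1 hbs hγ hx.1 hx.2 hs1 hs2 hs4 hs5
  have hab : Λ (solution B x 1) = Λ x + ((1 : ℕ) : ℝ) * β₀ :=
    dynAbel_shift hB hCm hθ0 hθ1 hbs hta h0 hts htf hprof hΛ hx hxs hxf p1 p2 1
  rw [hRx, hΛxk] at hab
  have he' : e' ∈ Ioc (0 : ℝ) e' := ⟨hx.1.trans_le hx.2, le_rfl⟩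
  have h1 : Λ e' ≤ Λ x := hanti.antitoneOn hx he' hx.2
  push_cast at hab
  linarith

/-- **RG TIME IS A COCYCLE ALONG THE TRAJECTORIES**: along every box solution h from `e ∈ ]0, e′]` (part 10's package at e), `T(h k) = T(e) + k` — each renormalization step
adds one unit of RG time. [folklore] -/
theorem rg_time_solution {B : (ℕ → ℝ) → ℝ} {Cm θ γ β₀ bs ta gs e' e : ℝ} {t : ℕ → ℝ} {a : ℕ → ℝ} {Λ : ℝ → ℝ} {h : ℕ → ℝ}
    (hB : MemoryProfile Cm θ γ B) (hCm : 0 ≤ Cm) (hθ0 : 0 ≤ θ) (hθ1 : θ < 1) (hbs : 0 < bs) (hta : 0 < ta)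
    (h0 : ∀ u : ℕ → ℝ, SeqBox γ u → |B u - β₀| ≤ Cm * ∑' j, θ ^ j * u j)
    (hts : SeqBox γ t) (htf : MemFlow B gs t) (hprof : ∀ m : ℕ, 1 / ta ^ 2 + bs * (m : ℝ) ≤ 1 / (t m) ^ 2)
    (hΛ : ∀ e ∈ Ioc (0 : ℝ) e', ∀ h : ℕ → ℝ, SeqBox γ h → MemFlow B e h → Tendsto (fun n => 1 / h n ^ 2 - a n) atTop (𝓝 (Λ e)))
    (hβ₀ : 0 < β₀) (he : e ∈ Ioc (0 : ℝ) e') (hhs : SeqBox γ h) (hhf : MemFlow B e h)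
    (hs1 : 4 * Cm * e ≤ bs * (1 - θ))
    (hs2 : e ^ 2 * (1 / gs ^ 2 + Cm * γ / (1 - θ) ^ 2 + (2 * Cm / ((1 - θ) * bs)) ^ 2) ≤ 3 / 4) (k : ℕ) :
    (Λ (h k) - Λ e') / β₀ = (Λ e - Λ e') / β₀ + (k : ℝ) := by
  rw [dynAbel_shift hB hCm hθ0 hθ1 hbs hta h0 hts htf hprof hΛ he hhs hhf hs1 hs2 k]
  field_simp
  ring

end

end Summit.QuantumFields.BalabanUV.Beta.EriceFlowEnclosureB12AsPrintedHistoryContagionShiftFlowZeroSemigroupBackward
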